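import Literature.NumberTheory.PAdicHodge.DeRhamCyclotomicExtension
import Literature.NumberTheory.PAdicHodge.BdRUnramified
import Literature.NumberTheory.GaloisRepresentations.AdmissibleTwist
import Literature.NumberTheory.GaloisRepresentations.ModNCyclotomicCharacter
import HarnessLib

/-!
# Ordinary two-step representations are de Rham: an extension of an unramified character by an
# unramified twist of `ℚ_p(1)` (Bloch–Kato 1990, Cor. 3.8.4 / Ex. 3.9; Perrin-Riou, *Représentations
# p-adiques ordinaires*) — the ordinary sector of "`V_pE` is de Rham"

Topic `NumberTheory/PAdicHodge`; theorems only (no definition, no named fact, no instance).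

Let `F` be a `p`-adic field (any `ℚ_p`-algebra structure), `B_dR(F)` the tree's `bdRPeriodRingData hp`,
`ρ` a continuous representation of `Γ_F` on a finite-dimensional `ℚ_p`-vector space `M` (module topology),
`N ≤ M` a subspace, and `η₁, η₂ : Γ_F →ₜ* ℤ_pˣ` UNRAMIFIED continuous characters (`= 1` on the inertia group
`absInertia F`). Suppose `Γ_F` acts on `N` through `η₁ χ_cyclo` and on `M ⧸ N` through `η₂`
(`ρ σ m − η₂(σ) m ∈ N`). Then **`ρ` is de Rham** (`isDeRham_of_ordinary`).

Proof. (1) `exists_unit_period_of_unramified`: an unramified `η` has a period `u = ι(X)`,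
`η(σ)·σ(u) = u`, which is a unit of `W(k̄) ⊆ B_dR⁺` (Lang's theorem over `W(k̄)`, tree
`exists_isUnit_forall_eq_mul_wittGal` at `N = 1`, and the equivariant `W(k̄) → B_dR`, `UnramifiedWittBdR`).
(2) Abstract rank-bookkeeping for ANY period-ring datum (`PeriodRingData.*_of_scalar_period`): if `Γ` acts on
a stable `N` through a scalar function `φ` with a nonzero period `w` then `w ⊗ n ∈ D(ρ|_N)`, `ρ|_N` is
admissible, and `Fil^i D(ρ|_N) = 0` as soon as `w ∉ Fil^i B`. (3) Twist `ρ` by `η₂⁻¹` (a representation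
`ρ'` on the same space, built inside the proof): the quotient becomes trivial and `N` carries the character
`η₁η₂⁻¹χ` with period `u·t⁻¹ ∉ B_dR⁺`; so `ρ'` is de Rham by the dévissage
`isDeRham_of_subrepresentation_of_trivial_quotient` (Kato II Prop. 1.2.3), and `ρ = η₂ ⊗ ρ'` by twist
stability (`isAdmissible_of_twist_period`, period of `η₂` from (1)).

Motivation (BSD cell `bsd-wall`, crux K★ `stmt-BirchSwinnertonDyer-22226`, stub hDR
`isDeRham_restrictedRationalTateRep`): an elliptic curve with good ORDINARY (or multiplicative) reduction over
`F` has `0 → ℚ_p(η₁χ) → V_pE → ℚ_p(η₂) → 0` with `η₁ = η₂⁻¹` unramified (connected–étale sequence of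
`E[p^∞]`, Weil pairing); this file makes `V_pE` de Rham in that sector with NO `B_cris` and NO explicit periods
of `E`. Bloch–Kato Cor. 3.8.4 (`dim H¹_f = dim D_dR/D⁰_dR + dim H⁰`) ⇒ `H¹_g(F, ℚ_p(ηχ)) = H¹(F, ℚ_p(ηχ))` is the
printed form.

## References

* [BlochKato1990] S. Bloch, K. Kato (1990), Cor. 3.8.4, Example 3.9.
* [PerrinRiou1994Ordinaires] B. Perrin-Riou, *Représentations p-adiques ordinaires*, Astérisque 223 (1994), §1.
* [FontaineAsterisque223III] J.-M. Fontaine, Astérisque 223 (1994), Exp. III §1.5 (Prop. 1.5.2), §5.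
* [Kato1993LNM1553] K. Kato, LNM 1553 (1993), Ch. II Prop. 1.2.3.
-/

noncomputable section

open scoped TensorProduct MatrixGroups
open TensorProduct Field ValuativeRel

universe u v v' w w'

/-! ### Abstract: a stable subspace carrying a scalar character with a period -/

namespace Literature.NumberTheory.GaloisRepresentations.PeriodRingData

-- Mathlib's own global value; see the implementation note of `PAdicHodgeProofs.lean`.
set_option maxSynthPendingDepth 3

variable {Γ : Type u} [Group Γ] [TopologicalSpace Γ] {P : Type v} {E : Type v'} [Field P]
  [TopologicalSpace P] [Field E] [Algebra P E]
  {M : Type w'} [AddCommGroup M] [Module P M] [TopologicalSpace M]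
  (𝔅 : PeriodRingData.{u, v, v', w} Γ P E) (ρ : ContinuousRep Γ P M)

/-- A subspace on which `Γ` acts through a scalar function is stable. [folklore] -/
private theorem stable_of_scalar (N : Submodule P M) {φ : Γ → P} (hφ : ∀ (g : Γ) (n : M), n ∈ N → ρ g n = φ g • n) :
    ∀ g : Γ, N ≤ N.comap (ρ g) := by
  intro g n hn
  change ρ g n ∈ N
  rw [hφ g n hn]
  exact N.smul_mem _ hn

/-- **`w ⊗ n ∈ D(ρ|_N)`** when `Γ` acts on `N` through `φ` and `w` is a period of `φ` (`φ(σ)·σ(w) = w`):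
`σ(w ⊗ n) = σ(w) ⊗ φ(σ)n = φ(σ)σ(w) ⊗ n = w ⊗ n`. [cite: FontaineAsterisque223III, Exp. III §1.5] -/
theorem tmul_mem_D_of_scalar_period (N : Submodule P M) {φ : Γ → P}
    (hφ : ∀ (g : Γ) (n : M), n ∈ N → ρ g n = φ g • n) {w : 𝔅.B}
    (hw : ∀ σ : Γ, algebraMap P 𝔅.B (φ σ) * σ • w = w) (n : N) :
    w ⊗ₜ[P] n ∈ 𝔅.D (ρ.subrepresentation N (stable_of_scalar ρ N hφ)) := by
  rw [mem_D_iff]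
  intro σ
  have hact : ρ.subrepresentation N (stable_of_scalar ρ N hφ) σ n = φ σ • n :=
    Subtype.ext (by rw [ContinuousRep.subrepresentation_apply_coe, Submodule.coe_smul, hφ σ n n.2])
  rw [tensorRep_apply_tmul, hact, tmul_smul, smul_tmul', Algebra.smul_def, hw]

omit [TopologicalSpace Γ] [TopologicalSpace P] [TopologicalSpace M] in
/-- The `w ⊗ n_j` along a basis `(n_j)` of `N` are `E`-linearly independent for a unit `w` (they form a
`B`-basis of `B ⊗ N`). [cite: FontaineAsterisque223III, Exp. III §1.5] -/
theorem linearIndependent_tmul_of_isUnit (N : Submodule P M) {ι : Type*} [Fintype ι]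
    (nb : Module.Basis ι P N) {w : 𝔅.B} (hw : IsUnit w) :
    LinearIndependent E (fun j => w ⊗ₜ[P] (nb j)) := by
  have hB : LinearIndependent 𝔅.B (fun j => (1 : 𝔅.B) ⊗ₜ[P] (nb j)) := by
    have h := (Algebra.TensorProduct.basis 𝔅.B nb).linearIndependent
    have hfun : ⇑(Algebra.TensorProduct.basis 𝔅.B nb) = fun j => (1 : 𝔅.B) ⊗ₜ[P] (nb j) :=
      funext fun j => Algebra.TensorProduct.basis_apply nb j
    rwa [hfun] at h
  have hB' : LinearIndependent 𝔅.B (fun j => w ⊗ₜ[P] (nb j)) := by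
    have h := hB.units_smul (fun _ => hw.unit)
    have hfun : ((fun _ : ι => hw.unit) • fun j => (1 : 𝔅.B) ⊗ₜ[P] (nb j)) = fun j => w ⊗ₜ[P] (nb j) := by
      funext j
      rw [Pi.smul_apply', Units.smul_def, IsUnit.unit_spec, smul_tmul', smul_eq_mul, mul_one]
    rwa [hfun] at h
  refine hB'.restrict_scalars ?_
  intro r r' hrr'
  have h' : algebraMap E 𝔅.B r = algebraMap E 𝔅.B r' := by
    simpa only [Algebra.smul_def, mul_one] using hrr'
  exact (algebraMap E 𝔅.B).injective h'

/-- **`ρ|_N` is admissible** when `Γ` acts on `N` through a scalar function `φ` with a nonzero period `w`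
(`w` is then a unit, regularity (iii)): `D(ρ|_N) ⊇ ⊕_j E·(w ⊗ n_j)`. [cite: FontaineAsterisque223III, Exp. III §1.5 (Prop. 1.5.2)] -/
theorem isAdmissible_subrepresentation_of_scalar_period [FiniteDimensional P M] (N : Submodule P M)
    {φ : Γ → P} (hφ : ∀ (g : Γ) (n : M), n ∈ N → ρ g n = φ g • n) {w : 𝔅.B} (hw0 : w ≠ 0)
    (hw : ∀ σ : Γ, algebraMap P 𝔅.B (φ σ) * σ • w = w) :
    𝔅.IsAdmissible (ρ.subrepresentation N (stable_of_scalar ρ N hφ)) := by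
  classical
  set ρN := ρ.subrepresentation N (stable_of_scalar ρ N hφ) with hρN
  have hwu : IsUnit w := 𝔅.isUnit_of_period hw0 hw
  let nb := Module.finBasis P N
  haveI : Module.Finite E (𝔅.D ρN) := 𝔅.finite_D ρN
  have hspan : Submodule.span E (Set.range fun j => w ⊗ₜ[P] (nb j)) ≤ 𝔅.D ρN := by
    refine Submodule.span_le.mpr ?_
    rintro _ ⟨j, rfl⟩
    exact 𝔅.tmul_mem_D_of_scalar_period ρ N hφ hw (nb j)
  refine le_antisymm (𝔅.finrank_D_le_holds ρN) ?_
  calc Module.finrank P N = Fintype.card (Fin (Module.finrank P N)) := (Fintype.card_fin _).symm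
    _ = Module.finrank E (Submodule.span E (Set.range fun j => w ⊗ₜ[P] (nb j))) :=
        (finrank_span_eq_card (𝔅.linearIndependent_tmul_of_isUnit N nb hwu)).symm
    _ ≤ Module.finrank E (𝔅.D ρN) := Submodule.finrank_mono hspan

/-- **`Fil^i D(ρ|_N) = 0` when the period `w ∉ Fil^i B`**: `D(ρ|_N) = ⊕_j E·(w ⊗ n_j)`, and coordinates
along a basis detect the filtration. [cite: FontaineAsterisque223III, Exp. III §1.5] -/
theorem filD_subrepresentation_eq_bot_of_scalar_period [FiniteDimensional P M] (N : Submodule P M)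
    {φ : Γ → P} (hφ : ∀ (g : Γ) (n : M), n ∈ N → ρ g n = φ g • n) {w : 𝔅.B} (hw0 : w ≠ 0)
    (hw : ∀ σ : Γ, algebraMap P 𝔅.B (φ σ) * σ • w = w) {i : ℤ} (hwi : w ∉ 𝔅.fil i) :
    𝔅.filD (ρ.subrepresentation N (stable_of_scalar ρ N hφ)) i = ⊥ := by
  classical
  set ρN := ρ.subrepresentation N (stable_of_scalar ρ N hφ) with hρN
  have hwu : IsUnit w := 𝔅.isUnit_of_period hw0 hw
  let nb := Module.finBasis P N
  haveI : Module.Finite E (𝔅.D ρN) := 𝔅.finite_D ρN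
  have hli := 𝔅.linearIndependent_tmul_of_isUnit (E := E) N nb hwu
  have hspan : Submodule.span E (Set.range fun j => w ⊗ₜ[P] (nb j)) ≤ 𝔅.D ρN := by
    refine Submodule.span_le.mpr ?_
    rintro _ ⟨j, rfl⟩
    exact 𝔅.tmul_mem_D_of_scalar_period ρ N hφ hw (nb j)
  have hDeq : Submodule.span E (Set.range fun j => w ⊗ₜ[P] (nb j)) = 𝔅.D ρN := by
    refine Submodule.eq_of_le_of_finrank_eq hspan ?_
    rw [finrank_span_eq_card hli, Fintype.card_fin]
    exact (𝔅.isAdmissible_subrepresentation_of_scalar_period ρ N hφ hw0 hw).symm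
  rw [eq_bot_iff]
  intro x hx
  rw [mem_filD_iff] at hx
  have hxD : (x : 𝔅.B ⊗[P] N) ∈ Submodule.span E (Set.range fun j => w ⊗ₜ[P] (nb j)) := by
    rw [hDeq]; exact x.2
  obtain ⟨c, hc⟩ := (Submodule.mem_span_range_iff_exists_fun E).mp hxD
  have hsum : (x : 𝔅.B ⊗[P] N) = ∑ j, (c j • w) ⊗ₜ[P] (nb j) := by
    rw [← hc]
    exact Finset.sum_congr rfl fun j _ => by rw [smul_tmul']
  have hcoord : ∀ j, c j • w ∈ 𝔅.fil i := by
    have hx' : ∑ j, (c j • w) ⊗ₜ[P] (nb j) ∈ 𝔅.filTensor N i := by rw [← hsum]; exact hx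
    exact 𝔅.mem_fil_of_sum_tmul_mem_filTensor nb hx'
  have hc0 : ∀ j, c j = 0 := fun j => by
    by_contra hj
    apply hwi
    have h := (𝔅.fil i).smul_mem (c j)⁻¹ (hcoord j)
    rwa [inv_smul_smul₀ hj] at h
  rw [Submodule.mem_bot]
  apply Subtype.ext
  rw [hsum, Submodule.coe_zero]
  exact Finset.sum_eq_zero fun j _ => by rw [hc0 j, zero_smul, zero_tmul]

end Literature.NumberTheory.GaloisRepresentations.PeriodRingData

/-! ### Genuine: unramified periods in `B_dR(F)` and the ordinary theorem -/

namespace Literature.NumberTheory.PAdicHodge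

open Literature.NumberTheory.GaloisRepresentations
open Literature.NumberTheory.GaloisRepresentations.IsNonarchimedeanLocalField

-- Mathlib's own global value; see the implementation note of `PAdicHodgeProofs.lean`.
set_option maxSynthPendingDepth 3

variable {F : Type} [Field F] [ValuativeRel F] [TopologicalSpace F] [IsNonarchimedeanLocalField F]
  [CharZero F] {p : ℕ} [Fact p.Prime] [Fact (¬ IsUnit (p : integerC F))]
  [IsAdicComplete (Ideal.span {(p : integerC F)}) (integerC F)] (hp : valuation F p < 1) [Algebra ℚ_[p] F]

/-- **An unramified character has a unit period in `B_dR⁺(F)`**: for a continuous `η : Γ_F → ℤ_pˣ` trivial on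
inertia there is `u ∈ B_dR(F)`, a unit with `u, u⁻¹ ∈ Fil⁰ = B_dR⁺` (the image of a unit of `W(k̄)`), such that
`η(σ)·σ(u) = u` for all `σ` — Lang's theorem over `W(k̄)` (tree `exists_isUnit_forall_eq_mul_wittGal`, rank `1`)
pushed along the equivariant `W(k̄) → B_dR` (`UnramifiedWittBdR`).
[cite: FontaineAsterisque223III, Exp. III §1.5 and §5] [cite: SerreLocalFields1979, Ch. XIII §5] -/
theorem exists_unit_period_of_unramified (η : absoluteGaloisGroup F →ₜ* ℤ_[p]ˣ)
    (hη : ∀ σ ∈ absInertia F, η σ = 1) :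
    ∃ u u' : (bdRPeriodRingData (F := F) (p := p) hp).B,
      u' * u = 1 ∧ u ∈ (bdRPeriodRingData (F := F) (p := p) hp).fil 0 ∧
      u' ∈ (bdRPeriodRingData (F := F) (p := p) hp).fil 0 ∧
      ∀ σ : absoluteGaloisGroup F,
        algebraMap ℚ_[p] (bdRPeriodRingData (F := F) (p := p) hp).B (((η σ : ℤ_[p]ˣ) : ℤ_[p]) : ℚ_[p]) * σ • u = u := by
  classical
  have hF := surjective_fontaineTheta_integerC (F := F) (p := p) hp
  haveI : IsDomain (BDeRhamPlus (integerC F) p) := isDomain_bDeRhamPlus (F := F) (p := p) hF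
  haveI : Fact (¬ IsUnit (p : maxUnramifiedCompletion F)) := ⟨not_isUnit_natCast_completion hp⟩
  haveI : CharP (IsLocalRing.ResidueField (maxUnramifiedCompletion F)) p := charP_residueField_completion
  set 𝔅 := bdRPeriodRingData (F := F) (p := p) hp with h𝔅
  -- the rank-one framed representation of `η` is unramified
  set r : absoluteGaloisGroup F →ₜ* GL (Fin 1) ℤ_[p] := FramedRep.ofCharacter η with hr_def
  have hr : ∀ σ ∈ absInertia F, r σ = 1 := by
    intro σ hσ
    refine Units.ext (Matrix.ext fun i j => ?_)
    rw [hr_def, FramedRep.ofCharacter_apply_coe, hη σ hσ, Units.val_one, Units.val_one, Matrix.one_apply,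
      if_pos (Subsingleton.elim i j)]
  obtain ⟨X, hXu, hX⟩ := exists_isUnit_forall_eq_mul_wittGal (p := p) r hr
  -- the entry `X 0 0` is a unit of `W(k̄)`
  have hX00 : IsUnit (X 0 0) := by
    have h := (Matrix.isUnit_iff_isUnit_det X).mp hXu
    rwa [Matrix.det_unique] at h
  obtain ⟨x, hx⟩ := hX00
  let ι : WittVector p (IsLocalRing.ResidueField (maxUnramifiedCompletion F)) →+* 𝔅.B := wittToFracBdR F p
  refine ⟨ι (X 0 0), ι (↑x⁻¹ : WittVector p (IsLocalRing.ResidueField (maxUnramifiedCompletion F))), ?_, ?_, ?_, ?_⟩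
  · rw [← map_mul, ← hx, Units.inv_mul, map_one]
  · exact wittToFracBdR_mem_fil_zero hp hF (X 0 0)
  · exact wittToFracBdR_mem_fil_zero hp hF _
  · intro σ
    -- entry `(0,0)` of `X = R(σ) · σ(X)`
    have h00 : X 0 0 = padicIntToWitt F p ((η σ : ℤ_[p]ˣ) : ℤ_[p]) * wittGal σ (X 0 0) := by
      have h := congrArg (fun Y : Matrix (Fin 1) (Fin 1) _ => Y 0 0) (hX σ)
      simp only [Matrix.mul_apply, Fintype.sum_unique, wittPeriodCoeff_apply, wittGalMatrix_apply] at h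
      rw [hr_def, FramedRep.ofCharacter_apply_coe] at h
      exact h
    have hιp : ι (padicIntToWitt F p ((η σ : ℤ_[p]ˣ) : ℤ_[p])) =
        algebraMap ℚ_[p] 𝔅.B (((η σ : ℤ_[p]ˣ) : ℤ_[p]) : ℚ_[p]) :=
      (wittToFracBdR_eq (padicIntToWitt F p) _).trans (algebraMap_padic_bdRPeriodRingData hp _).symm
    have hισ : σ • ι (X 0 0) = ι (wittGal σ (X 0 0)) := smul_wittToFracBdR σ (X 0 0)
    conv_rhs => rw [h00, map_mul, hιp, ← hισ]

variable {M : Type} [AddCommGroup M] [Module ℚ_[p] M] [TopologicalSpace M] [IsTopologicalAddGroup M]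
  [ContinuousSMul ℚ_[p] M] [Module.Finite ℚ_[p] M] [IsModuleTopology ℚ_[p] M]

/-- **Ordinary two-step representations are de Rham.** Let `η₁, η₂ : Γ_F → ℤ_pˣ` be continuous unramified
characters, `N ≤ M` a subspace on which `Γ_F` acts through `η₁ χ_cyclo`, with `Γ_F` acting on `M ⧸ N` through
`η₂`. Then `ρ` is de Rham for `B_dR(F)` (every `p`-adic field `F`, every `ℚ_p`-algebra structure).
Proof: twist by `η₂⁻¹`, dévissage with trivial quotient (Kato II Prop. 1.2.3; the line character `η₁η₂⁻¹χ`
has period `u·t⁻¹ ∉ B_dR⁺`, so `D⁰_dR = 0`), twist back (period of `η₂` is a unit of `W(k̄) ⊆ B_dR⁺`).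
[cite: BlochKato1990, Cor. 3.8.4 and Example 3.9] [cite: PerrinRiou1994Ordinaires, §1]
[cite: FontaineAsterisque223III, Exp. III Prop. 1.5.2] -/
theorem isDeRham_of_ordinary (ρ : GaloisRep F ℚ_[p] M) (N : Submodule ℚ_[p] M)
    (η₁ η₂ : absoluteGaloisGroup F →ₜ* ℤ_[p]ˣ)
    (hη₁ : ∀ σ ∈ absInertia F, η₁ σ = 1) (hη₂ : ∀ σ ∈ absInertia F, η₂ σ = 1)
    (hN : ∀ (g : absoluteGaloisGroup F) (n : M), n ∈ N →
      ρ g n = (((η₁ g * GaloisRep.cyclotomicCharacter F p g : ℤ_[p]ˣ) : ℤ_[p]) : ℚ_[p]) • n)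
    (hQ : ∀ (g : absoluteGaloisGroup F) (m : M), ρ g m - (((η₂ g : ℤ_[p]ˣ) : ℤ_[p]) : ℚ_[p]) • m ∈ N) :
    GaloisRep.IsDeRham (bdRPeriodRingData (F := F) (p := p) hp) ρ := by
  classical
  have hF := surjective_fontaineTheta_integerC (F := F) (p := p) hp
  haveI : IsDomain (BDeRhamPlus (integerC F) p) := isDomain_bDeRhamPlus (F := F) (p := p) hF
  set 𝔅 := bdRPeriodRingData (F := F) (p := p) hp with h𝔅
  -- the scalar functions
  let c₂ : absoluteGaloisGroup F → ℚ_[p] := fun g => (((η₂ g : ℤ_[p]ˣ) : ℤ_[p]) : ℚ_[p])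
  let c₂' : absoluteGaloisGroup F → ℚ_[p] := fun g => ((((η₂ g)⁻¹ : ℤ_[p]ˣ) : ℤ_[p]) : ℚ_[p])
  have hc₂c₂' : ∀ g, c₂' g * c₂ g = 1 := fun g => by
    simp only [c₂, c₂']
    rw [← PadicInt.coe_mul, ← Units.val_mul, inv_mul_cancel, Units.val_one, PadicInt.coe_one]
  have hc₂'mul : ∀ g h, c₂' (g * h) = c₂' g * c₂' h := fun g h => by
    simp only [c₂']
    rw [map_mul, mul_inv, Units.val_mul, PadicInt.coe_mul]
  have hc₂'cont : Continuous c₂' := by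
    have h2 : Continuous fun g : absoluteGaloisGroup F => (((η₂ g)⁻¹ : ℤ_[p]ˣ) : ℤ_[p]) :=
      Units.continuous_coe_inv.comp (map_continuous η₂)
    have h3 : Continuous (fun z : ℤ_[p] => (z : ℚ_[p])) := continuous_subtype_val
    exact h3.comp h2
  -- the twisted representation `ρ' = η₂⁻¹ ⊗ ρ` on the same space
  let ρ' : GaloisRep F ℚ_[p] M :=
    { toRepresentation :=
        { toFun := fun g => c₂' g • ρ g
          map_one' := by
            ext m
            simp only [c₂', map_one, inv_one, Units.val_one, PadicInt.coe_one, one_smul]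
          map_mul' := fun g h => by
            ext m
            simp only [LinearMap.smul_apply, Module.End.mul_apply, map_mul, LinearMap.map_smul, hc₂'mul,
              mul_smul] }
      continuous_smul := by
        change Continuous fun q : absoluteGaloisGroup F × M => (c₂' q.1 • ρ q.1) q.2
        simp only [LinearMap.smul_apply]
        exact (hc₂'cont.comp continuous_fst).smul ρ.continuous_smul }
  have hρ' : ∀ g m, ρ' g m = c₂' g • ρ g m := fun g m => rfl
  -- `ρ = η₂ ⊗ ρ'`
  have htw : ∀ g m, ρ g m = c₂ g • ρ' g m := fun g m => by
    rw [hρ', ← mul_smul, mul_comm, hc₂c₂', one_smul]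
  -- `Γ_F` acts on `N` through `ψ χ` for `ρ'`, `ψ = η₁ η₂⁻¹`, and trivially on `M ⧸ N`
  let ψ : absoluteGaloisGroup F →ₜ* ℤ_[p]ˣ := η₁ * η₂⁻¹
  have hψ : ∀ σ ∈ absInertia F, ψ σ = 1 := fun σ hσ => by
    change η₁ σ * (η₂ σ)⁻¹ = 1
    rw [hη₁ σ hσ, hη₂ σ hσ, inv_one, mul_one]
  let φ : absoluteGaloisGroup F → ℚ_[p] := fun g =>
    (((ψ g : ℤ_[p]ˣ) : ℤ_[p]) : ℚ_[p]) * (((GaloisRep.cyclotomicCharacter F p g : ℤ_[p]ˣ) : ℤ_[p]) : ℚ_[p])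
  have hN' : ∀ (g : absoluteGaloisGroup F) (n : M), n ∈ N → ρ' g n = φ g • n := by
    intro g n hn
    rw [hρ', hN g n hn, ← mul_smul]
    congr 1
    simp only [c₂', φ, ψ]
    change _ = (((η₁ g * (η₂ g)⁻¹ : ℤ_[p]ˣ) : ℤ_[p]) : ℚ_[p]) * _
    simp only [Units.val_mul, PadicInt.coe_mul]
    ring
  have htriv' : ∀ (g : absoluteGaloisGroup F) (m : M), ρ' g m - m ∈ N := by
    intro g m
    have h : ρ' g m - m = c₂' g • (ρ g m - c₂ g • m) := by
      rw [hρ', smul_sub, ← mul_smul, hc₂c₂', one_smul]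
    rw [h]
    exact N.smul_mem _ (hQ g m)
  -- periods: `u` for `ψ` (unit of `B_dR⁺`), `t⁻¹` for `χ`, `u₂` for `η₂`
  obtain ⟨u, u', huu', -, hu'fil, hu⟩ := exists_unit_period_of_unramified hp ψ hψ
  obtain ⟨u₂, u₂', hu₂u₂', -, -, hu₂⟩ := exists_unit_period_of_unramified hp η₂ hη₂
  set s : 𝔅.B := (show 𝔅.B from ((tFrac : FracBdR F p)⁻¹ : FracBdR F p)) with hs
  have hsper : ∀ σ, algebraMap ℚ_[p] 𝔅.B
      (((GaloisRep.cyclotomicCharacter F p σ : ℤ_[p]ˣ) : ℤ_[p]) : ℚ_[p]) * σ • s = s := fun σ => by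
    have h := bdRPeriodRingData_period hp (algebraMap_padic_eq_padicRingHom hp) σ
    rw [PeriodRingData.chi, cyclotomicRepQp_apply, mul_one] at h
    exact h
  have hw : ∀ σ, algebraMap ℚ_[p] 𝔅.B (φ σ) * σ • (u * s) = u * s := 𝔅.period_mul hu hsper
  have hu0 : u ≠ 0 := fun h0 => by
    rw [h0, mul_zero] at huu'
    exact zero_ne_one huu'
  have hs0 : s ≠ 0 := inv_ne_zero (tFrac_ne_zero hF)
  have hw0 : u * s ≠ 0 := mul_ne_zero hu0 hs0
  -- `u t⁻¹ ∉ B_dR⁺`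
  have hwfil : u * s ∉ 𝔅.fil 0 := by
    intro hmem
    have h1 : u' * (u * s) ∈ 𝔅.fil (0 + 0) := 𝔅.mul_mem_fil 0 0 _ _ hu'fil hmem
    rw [← mul_assoc, huu', one_mul, add_zero] at h1
    have h2 := (tFrac_inv_mem_fil_iff hF hp 0).mp h1
    omega
  -- dévissage for `ρ'`
  have hadm' : 𝔅.IsAdmissible (ρ'.subrepresentation N (PeriodRingData.stable_of_scalar ρ' N hN')) :=
    𝔅.isAdmissible_subrepresentation_of_scalar_period ρ' N hN' hw0 hw
  have hfil' : 𝔅.filD (ρ'.subrepresentation N (PeriodRingData.stable_of_scalar ρ' N hN')) 0 = ⊥ :=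
    𝔅.filD_subrepresentation_eq_bot_of_scalar_period ρ' N hN' hw0 hw hwfil
  have hdR' : GaloisRep.IsDeRham 𝔅 ρ' :=
    isDeRham_of_subrepresentation_of_trivial_quotient hp ρ' N (PeriodRingData.stable_of_scalar ρ' N hN')
      htriv' hadm' hfil'
  -- twist back by `η₂`
  have hu₂0 : u₂ ≠ 0 := fun h0 => by
    rw [h0, mul_zero] at hu₂u₂'
    exact zero_ne_one hu₂u₂'
  exact 𝔅.isAdmissible_of_twist_period ρ' ρ c₂ htw hu₂0 hu₂ hdR'

end Literature.NumberTheory.PAdicHodge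

end
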